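import Summits.AnomalousDissipation.AnomalousDissipation.Theorems.SolenoidalFractalHomogenisationLagrangianStepSidebandXEnergyDefsFrame
import Summits.AnomalousDissipation.AnomalousDissipation.Theorems.SolenoidalFractalHomogenisationLagrangianStepSidebandXSlowDefs
import HarnessLib

/-!
# K1L_D `LagrangianRenormalisationStepDesign` (stmt-AnomalousDissipation-27980), registered stub `stub_D1_V0thg` (v28, D28-3 (3)/D28-6/D28-7), port-map layer L5:
# the TWISTED slow equation in forced form — perturbation operator, period mean and forcing (shared definitions; reviewed;
# `--kind definition --supports stmt-AnomalousDissipation-27980 --as helper`)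

Summits-side DEFINITIONS file of route `SolenoidalFractalHomogenisation` (prover seat `ad-k1l-cellLawV-w1` g9; road of record D28-7 = port map §3 L5).  Frozen-frame twin of
`…SidebandXSlowDefs`: `slowPertθ t = Σ_{jj'} ξⱼξ_{j'} • P^θ_ℓ ∘ feedbackⱼ(t) ∘ Nθ_{j'}(t)` (link factors `ξⱼ = êⱼ·ℓ/n` FLAT, projection twisted), `slowMeanθ = Σ ξⱼξ_{j'} • P^θ_ℓ ∘ Mθ_{jj'}`,
`slowForcingθ`; unfolding / `_apply` lemmas.  NOT a proof of anything; rung F-D1.A0 infrastructure.  AD is not proved.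
-/

set_option linter.dupNamespace false

noncomputable section

namespace Summit.AnomalousDissipation.AnomalousDissipation.Theorems.SolenoidalFractalHomogenisation.LagrangianStep.Sideband

open Set MeasureTheory Complex UnitAddTorus
open scoped InnerProductSpace
open Literature.Analysis Literature.Analysis.FunctionSpaces Literature.Analysis.FunctionSpaces.Torus
open Literature.Analysis.FluidPDE Literature.Analysis.FluidPDE.Torus Literature.Analysis.FluidPDE.LatticeShear
open Summit.AnomalousDissipation.AnomalousDissipation.Theorems.SolenoidalFractalHomogenisation.LagrangianStep.CellChain (modeRepθ)

variable {k₀ : ℕ}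

/-! ## §1 The perturbation operator and its period mean -/

/-- **The slow perturbation operator** `slowPert t = Σ_{j j'} (ξⱼ ξ_{j'}) • P_ℓ ∘ feedbackⱼ(t) ∘ N_{j'}(t)` (ℝ-linear on `ℂ³`; `P`-periodic, continuous,
size `O(ξ²/ν)`). [cite: MajdaKramer1999, §2.2.1.3 (55) (effective diffusivity as a cell average)] [cite: SandersVerhulstMurdock2007, Theorem 2.8.1] -/
def slowPertθ (W₁ : LatticeWord k₀) (n : ℕ) (ℓ : Fin 3 → ℤ) (𝔸 : Torus.Visc4 (Fin 3)) (G₀ : Matrix (Fin 3) (Fin 3) ℝ) (R : ℕ) (t : ℝ) :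
    EuclideanSpace ℂ (Fin 3) →L[ℝ] EuclideanSpace ℂ (Fin 3) :=
  ∑ j, ∑ j', (xiCoeff W₁ n ℓ j * xiCoeff W₁ n ℓ j') •
    (((transversalProjR (twistFreq G₀ ℓ)).comp (feedback W₁ R j t)).restrictScalars ℝ).comp (responseExtθ W₁ 𝔸 G₀ 1 R j' t)

/-- Unfolding `slowPert`. [cite: MajdaKramer1999, §2.2.1.3 (55)] -/
theorem slowPertθ_def (W₁ : LatticeWord k₀) (n : ℕ) (ℓ : Fin 3 → ℤ) (𝔸 : Torus.Visc4 (Fin 3)) (G₀ : Matrix (Fin 3) (Fin 3) ℝ) (R : ℕ) (t : ℝ) :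
    slowPertθ W₁ n ℓ 𝔸 G₀ R t = ∑ j, ∑ j', (xiCoeff W₁ n ℓ j * xiCoeff W₁ n ℓ j') •
      (((transversalProjR (twistFreq G₀ ℓ)).comp (feedback W₁ R j t)).restrictScalars ℝ).comp (responseExtθ W₁ 𝔸 G₀ 1 R j' t) := rfl

/-- `slowPert` applied to a vector. [cite: MajdaKramer1999, §2.2.1.3 (55)] -/
theorem slowPertθ_apply (W₁ : LatticeWord k₀) (n : ℕ) (ℓ : Fin 3 → ℤ) (𝔸 : Torus.Visc4 (Fin 3)) (G₀ : Matrix (Fin 3) (Fin 3) ℝ) (R : ℕ) (t : ℝ) (v : EuclideanSpace ℂ (Fin 3)) :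
    slowPertθ W₁ n ℓ 𝔸 G₀ R t v = ∑ j, ∑ j', (xiCoeff W₁ n ℓ j * xiCoeff W₁ n ℓ j') •
      transversalProjR (twistFreq G₀ ℓ) (feedback W₁ R j t (responseExtθ W₁ 𝔸 G₀ 1 R j' t v)) := by
  simp only [slowPertθ, FunLike.coe_sum, Finset.sum_apply, FunLike.coe_smul, Pi.smul_apply, ContinuousLinearMap.comp_apply,
    ContinuousLinearMap.coe_restrictScalars']

/-- **The period mean of the slow perturbation** `slowMean = Σ_{j j'} (ξⱼ ξ_{j'}) • P_ℓ ∘ M_{jj'}`, `M_{jj'} = meanFeedbackθ W₁ 𝔸 G₀ 1 R j j'`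
(the slow generator of the `(1/ν)•psiStar` enhancement at `ℓ`, up to the right projection). [cite: MajdaKramer1999, §2.2.1.3 (55)] -/
def slowMeanθ (W₁ : LatticeWord k₀) (n : ℕ) (ℓ : Fin 3 → ℤ) (𝔸 : Torus.Visc4 (Fin 3)) (G₀ : Matrix (Fin 3) (Fin 3) ℝ) (R : ℕ) :
    EuclideanSpace ℂ (Fin 3) →L[ℝ] EuclideanSpace ℂ (Fin 3) :=
  ∑ j, ∑ j', (xiCoeff W₁ n ℓ j * xiCoeff W₁ n ℓ j') • ((transversalProjR (twistFreq G₀ ℓ)).restrictScalars ℝ).comp (meanFeedbackθ W₁ 𝔸 G₀ 1 R j j')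

/-- Unfolding `slowMean`. [cite: MajdaKramer1999, §2.2.1.3 (55)] -/
theorem slowMeanθ_def (W₁ : LatticeWord k₀) (n : ℕ) (ℓ : Fin 3 → ℤ) (𝔸 : Torus.Visc4 (Fin 3)) (G₀ : Matrix (Fin 3) (Fin 3) ℝ) (R : ℕ) :
    slowMeanθ W₁ n ℓ 𝔸 G₀ R =
      ∑ j, ∑ j', (xiCoeff W₁ n ℓ j * xiCoeff W₁ n ℓ j') • ((transversalProjR (twistFreq G₀ ℓ)).restrictScalars ℝ).comp (meanFeedbackθ W₁ 𝔸 G₀ 1 R j j') := rfl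

/-- `slowMean` applied to a vector. [cite: MajdaKramer1999, §2.2.1.3 (55)] -/
theorem slowMeanθ_apply (W₁ : LatticeWord k₀) (n : ℕ) (ℓ : Fin 3 → ℤ) (𝔸 : Torus.Visc4 (Fin 3)) (G₀ : Matrix (Fin 3) (Fin 3) ℝ) (R : ℕ) (v : EuclideanSpace ℂ (Fin 3)) :
    slowMeanθ W₁ n ℓ 𝔸 G₀ R v = ∑ j, ∑ j', (xiCoeff W₁ n ℓ j * xiCoeff W₁ n ℓ j') • transversalProjR (twistFreq G₀ ℓ) (meanFeedbackθ W₁ 𝔸 G₀ 1 R j j' v) := by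
  simp only [slowMeanθ, FunLike.coe_sum, Finset.sum_apply, FunLike.coe_smul, Pi.smul_apply, ContinuousLinearMap.comp_apply,
    ContinuousLinearMap.coe_restrictScalars']

/-! ## §2 The forcing -/

/-- **The forcing of the slow equation** `slowForcing t = −Σⱼ ξⱼ • P_ℓ feedbackⱼ(t) (r t + (projX (y t) − y t))` (`r = residualX`, `y = refState`).
[cite: MajdaKramer1999, §2.2.1.3 (55)] [cite: SandersVerhulstMurdock2007, Theorem 2.8.1] -/
def slowForcingθ (W₁ : LatticeWord k₀) (n : ℕ) (ℓ : Fin 3 → ℤ) (𝔸 : Torus.Visc4 (Fin 3)) (G₀ : Matrix (Fin 3) (Fin 3) ℝ) (R : ℕ)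
    (F : UnitAddTorus (Fin 3) → EuclideanSpace ℝ (Fin 3)) (w : ℝ → UnitAddTorus (Fin 3) → EuclideanSpace ℝ (Fin 3)) (t : ℝ) :
    EuclideanSpace ℂ (Fin 3) :=
  -∑ j, ((xiCoeff W₁ n ℓ j : ℝ) : ℂ) • transversalProjR (twistFreq G₀ ℓ) (feedback W₁ R j t
    (residualXθ W₁ n ℓ 𝔸 G₀ R F w t + (projXθ n ℓ G₀ R (refStateθ W₁ n ℓ 𝔸 G₀ R F w t) - refStateθ W₁ n ℓ 𝔸 G₀ R F w t)))

/-- Unfolding `slowForcing`. [cite: MajdaKramer1999, §2.2.1.3 (55)] -/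
theorem slowForcingθ_def (W₁ : LatticeWord k₀) (n : ℕ) (ℓ : Fin 3 → ℤ) (𝔸 : Torus.Visc4 (Fin 3)) (G₀ : Matrix (Fin 3) (Fin 3) ℝ) (R : ℕ)
    (F : UnitAddTorus (Fin 3) → EuclideanSpace ℝ (Fin 3)) (w : ℝ → UnitAddTorus (Fin 3) → EuclideanSpace ℝ (Fin 3)) (t : ℝ) :
    slowForcingθ W₁ n ℓ 𝔸 G₀ R F w t = -∑ j, ((xiCoeff W₁ n ℓ j : ℝ) : ℂ) • transversalProjR (twistFreq G₀ ℓ) (feedback W₁ R j t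
      (residualXθ W₁ n ℓ 𝔸 G₀ R F w t + (projXθ n ℓ G₀ R (refStateθ W₁ n ℓ 𝔸 G₀ R F w t) - refStateθ W₁ n ℓ 𝔸 G₀ R F w t))) := rfl

end Summit.AnomalousDissipation.AnomalousDissipation.Theorems.SolenoidalFractalHomogenisation.LagrangianStep.Sideband

end
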